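import Summits.AnomalousDissipation.AnomalousDissipation.Theorems.TaylorGreenLogLoudStates.Negative.LoadBearing

/-!
# Negative knowledge for the crux `TaylorGreenLogLoudStates` (stmt-AnomalousDissipation-14586, route MirrorVariety), II:
# a-priori ceilings, anatomy, the normalisation `ν_j ≤ 1/4`, the relation to crux #2, and what a refutation must prove

Certified copy of §2(e),(f) and §3 of the cdisprove work file `Cruxes/TaylorGreenLogLoudStates/Disproof.lean`
(refuter-cdisprove-stmt-AnomalousDissipation-14586-0, cycle 1). Supports stmt-AnomalousDissipation-14586; no positive
route-item statement is asserted (route decls appear only negated: `not_loud_of_not_logLoud`, `not_logCrux_iff`).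

* (e) `one_le_freqNormSq_of_ne_zero'`, `poincare_of_isBandLimited` (`4π²∫|U|² ≤ ‖∇U‖²` on the punctured ball),
  `sqrt_energy_le` (`√(∫|U|²) ≤ 1/(8π²ν)`), `energy_le` (`∫|U|² ≤ 1/(64π⁴ν²)`), `dissipation_le`
  (`ν‖∇U‖² ≤ 1/(16π²ν)`) — every admissible Taylor–Green state; the crux's log budget is binding.
* (f) `log_high_mode_dissipation_floor` — half the dissipation of a witness sits at `|k| > (c/8π²νE log(1/ν))^{1/2}`.
* §3 `logLoudStates_iff_unnormalised` (the clause `ν_j ≤ 1/4` is removable by a tail shift),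
  `logLoudStates_of_loudBoundedStates` (#2 ⇒ #3, `E' = max E 0 / log 4`), `not_loud_of_not_logLoud` (¬#3 → ¬#2: the
  route's kill criterion K2 made formal), `not_logCrux_iff` (¬crux = uniform-in-`N` laminarisation of steady Galerkin
  TG states at energy `O(log(1/ν))` along every `ν_j → 0⁺` — open in 3-D).
* §3b `ExactSteadyLogLaminarisation` (PDE form of ¬crux, OPEN, hypothesis only), `not_logCrux_of_exact_laminarisation`
  (modulo the route's support `FixedViscosityTransfer`, stmt-2991, laminarising EXACT steady weak solutions `u ∈ V` with
  the energy equation at energy `≤ E log(1/ν_j)` refutes the crux — no Galerkin truncation needs to be mentioned).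
-/

noncomputable section

open scoped InnerProductSpace Topology
open MeasureTheory Filter
open Literature.Analysis.FunctionSpaces Literature.Analysis.FunctionSpaces.Torus
open Summit.AnomalousDissipation.AnomalousDissipation.Theorems.TaylorGreenLoudGalerkinStates.Negative

namespace Summit.AnomalousDissipation.AnomalousDissipation.Theorems.TaylorGreenLogLoudStates.Negative

/-! ### (d) The witness must depend on `j`

Sibling `not_loud_with_one_state` (force- and energy-independent) applies verbatim: a single field cannot be loud along
`ν_j → 0`. Nothing to add. -/

/-! ### (e) A-priori ceilings every admissible Taylor–Green state meets (the log clause is binding) -/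

/-- An integer vector `k ≠ 0` has `|k|² ≥ 1`. [folklore] -/
theorem one_le_freqNormSq_of_ne_zero' {k : Fin 3 → ℤ} (hk : k ≠ 0) : (1 : ℝ) ≤ freqNormSq k := by
  obtain ⟨i, hi⟩ : ∃ i, k i ≠ 0 := by
    by_contra h
    push Not at h
    exact hk (funext h)
  have h1 : (1 : ℝ) ≤ ((k i : ℤ) : ℝ) ^ 2 := by
    have h2 : (1 : ℤ) ≤ (k i) ^ 2 := by
      have h3 := Int.one_le_abs hi
      nlinarith [sq_abs (k i), abs_nonneg (k i)]
    exact_mod_cast h2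
  calc (1 : ℝ) ≤ ((k i : ℤ) : ℝ) ^ 2 := h1
    _ ≤ freqNormSq k :=
        Finset.single_le_sum (f := fun j => ((k j : ℤ) : ℝ) ^ 2) (fun j _ => sq_nonneg _) (Finset.mem_univ i)

/-- **Poincaré on the punctured ball.** A smooth field band-limited to `0 < |k|² ≤ N²` has `4π² ∫|U|² ≤ ‖∇U‖²`
(Parseval; `Û(0) = 0` and `|k|² ≥ 1` otherwise). [folklore] -/
theorem poincare_of_isBandLimited {U : UnitAddTorus (Fin 3) → EuclideanSpace ℝ (Fin 3)} (hU : IsSmooth U)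
    {N : ℕ} (hband : IsBandLimited N U) :
    4 * Real.pi ^ 2 * ∫ x, ‖U x‖ ^ 2 ≤ gradNormSq U := by
  have hband' : ∀ k : Fin 3 → ℤ, (N : ℝ) ^ 2 < freqNormSq k →
      UnitAddTorus.mFourierCoeff (EuclideanSpace.complexify ∘ U) k = 0 := fun k hk =>
    hband k fun hmem => (not_mem_freqBall.2 hk) (Finset.mem_of_mem_erase hmem)
  have h0 : UnitAddTorus.mFourierCoeff (EuclideanSpace.complexify ∘ U) 0 = 0 :=
    hband 0 (Finset.notMem_erase 0 _)
  have hnn : 0 ≤ 4 * Real.pi ^ 2 * ∑ k ∈ freqBall N,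
      freqNormSq k * ‖UnitAddTorus.mFourierCoeff (EuclideanSpace.complexify ∘ U) k‖ ^ 2 :=
    mul_nonneg (by positivity) (Finset.sum_nonneg fun k _ =>
      mul_nonneg (Finset.sum_nonneg fun i _ => sq_nonneg _) (sq_nonneg _))
  rw [gradNormSq_eq_toReal_eGradNormSq_holds hU, eGradNormSq_eq_sum_of_band_limited hU.continuous hband',
    integral_norm_sq_eq_sum_of_band_limited hU.continuous hband', ENNReal.toReal_ofReal hnn, Finset.mul_sum,
    Finset.mul_sum]
  refine Finset.sum_le_sum fun k _ => ?_
  by_cases hk0 : k = 0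
  · subst hk0
    simp [h0]
  · have h1 : (1 : ℝ) ≤ freqNormSq k := one_le_freqNormSq_of_ne_zero' hk0
    have he : 0 ≤ ‖UnitAddTorus.mFourierCoeff (EuclideanSpace.complexify ∘ U) k‖ ^ 2 := sq_nonneg _
    calc 4 * Real.pi ^ 2 * ‖UnitAddTorus.mFourierCoeff (EuclideanSpace.complexify ∘ U) k‖ ^ 2
        = 4 * Real.pi ^ 2 * (1 * ‖UnitAddTorus.mFourierCoeff (EuclideanSpace.complexify ∘ U) k‖ ^ 2) := by ring
      _ ≤ 4 * Real.pi ^ 2 * (freqNormSq k * ‖UnitAddTorus.mFourierCoeff (EuclideanSpace.complexify ∘ U) k‖ ^ 2) := by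
        gcongr

/-- **A-priori amplitude ceiling.** Every admissible Taylor–Green state at `ν > 0` has `√(∫|U|²) ≤ 1/(8π²ν)`
(`4π²ν∫|U|² ≤ ν‖∇U‖² ≤ ½√(∫|U|²)`: Poincaré + injection ceiling; Temam 1979 Ch. II (1.25)). [folklore] -/
theorem sqrt_energy_le {ν : ℝ} {N : ℕ} {U : UnitAddTorus (Fin 3) → EuclideanSpace ℝ (Fin 3)} (hν : 0 < ν)
    (hU : IsSteadyState ν N tgForce U) : Real.sqrt (∫ x, ‖U x‖ ^ 2) ≤ 1 / (8 * Real.pi ^ 2 * ν) := by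
  have hP := poincare_of_isBandLimited hU.1 hU.2.2.2.1
  have hL := loudness_le_half_sqrt_energy hU
  set e := ∫ x, ‖U x‖ ^ 2 with he
  set s := Real.sqrt e with hs
  have he0 : 0 ≤ e := integral_nonneg fun _ => sq_nonneg _
  have h1 : 4 * Real.pi ^ 2 * ν * e ≤ 2⁻¹ * s := by
    nlinarith [mul_le_mul_of_nonneg_left hP hν.le]
  have hsq : e = s * s := (Real.mul_self_sqrt he0).symm
  rcases (Real.sqrt_nonneg e).lt_or_eq with hpos | hzero
  · rw [le_div_iff₀ (by positivity)]
    rw [hsq] at h1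
    by_contra hcon
    push Not at hcon
    nlinarith [mul_lt_mul_of_pos_right hcon hpos, h1]
  · rw [hs, ← hzero]
    positivity

/-- **A-priori energy ceiling** `∫|U|² ≤ 1/(64π⁴ν²)` for every admissible Taylor–Green state at `ν > 0`: the log
budget `E·log(1/ν)` of the crux is far below it, so the energy clause is binding (the laminar TG branch of the route's
toys has `E ∼ ν⁻¹…ν⁻²`). [folklore] -/
theorem energy_le {ν : ℝ} {N : ℕ} {U : UnitAddTorus (Fin 3) → EuclideanSpace ℝ (Fin 3)} (hν : 0 < ν)
    (hU : IsSteadyState ν N tgForce U) : ∫ x, ‖U x‖ ^ 2 ≤ 1 / (64 * Real.pi ^ 4 * ν ^ 2) := by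
  have h1 := sqrt_energy_le hν hU
  have he0 : 0 ≤ ∫ x, ‖U x‖ ^ 2 := integral_nonneg fun _ => sq_nonneg _
  have h2 : Real.sqrt (∫ x, ‖U x‖ ^ 2) ^ 2 ≤ (1 / (8 * Real.pi ^ 2 * ν)) ^ 2 :=
    pow_le_pow_left₀ (Real.sqrt_nonneg _) h1 2
  rw [Real.sq_sqrt he0] at h2
  calc ∫ x, ‖U x‖ ^ 2 ≤ (1 / (8 * Real.pi ^ 2 * ν)) ^ 2 := h2
    _ = 1 / (64 * Real.pi ^ 4 * ν ^ 2) := by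
        have hπ : Real.pi ≠ 0 := Real.pi_ne_zero
        field_simp
        ring

/-- **A-priori dissipation ceiling** `ν‖∇U‖² ≤ 1/(16π²ν)` for every admissible Taylor–Green state at `ν > 0`.
[folklore] -/
theorem dissipation_le {ν : ℝ} {N : ℕ} {U : UnitAddTorus (Fin 3) → EuclideanSpace ℝ (Fin 3)} (hν : 0 < ν)
    (hU : IsSteadyState ν N tgForce U) : ν * gradNormSq U ≤ 1 / (16 * Real.pi ^ 2 * ν) := by
  have h1 := loudness_le_half_sqrt_energy hU
  have h2 := sqrt_energy_le hν hU
  calc ν * gradNormSq U ≤ 2⁻¹ * Real.sqrt (∫ x, ‖U x‖ ^ 2) := h1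
    _ ≤ 2⁻¹ * (1 / (8 * Real.pi ^ 2 * ν)) := by gcongr
    _ = 1 / (16 * Real.pi ^ 2 * ν) := by
        have hπ : Real.pi ≠ 0 := Real.pi_ne_zero
        field_simp
        ring

/-! ### (f) Anatomy of a witness: dissipation at high wavenumbers -/

/-- **Log high-mode dissipation floor.** A witness state at `(ν, N)` (any force) dissipates at least
`c − 4π²νK²·E log(1/ν)` in the modes `|k| > K`, for every cutoff `K`: half of the dissipation sits at
`|k| > (c/8π²νE log(1/ν))^{1/2} → ∞`. [folklore] -/
theorem log_high_mode_dissipation_floor {ν E c : ℝ} {N : ℕ} {f U : UnitAddTorus (Fin 3) → EuclideanSpace ℝ (Fin 3)}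
    (hν : 0 ≤ ν) (hU : IsSteadyState ν N f U) (hE : ∫ x, ‖U x‖ ^ 2 ≤ E * Real.log (1 / ν))
    (hloud : c ≤ ν * gradNormSq U) (K : ℝ) :
    c - 4 * Real.pi ^ 2 * ν * K ^ 2 * (E * Real.log (1 / ν)) ≤ ν * highEnstrophy K N U :=
  high_mode_dissipation_floor hν hU hE hloud K

/-! ## §3 Relations: the normalisation `ν_j ≤ 1/4`, the sibling crux #2, and what a refutation must prove -/

/-- The log crux's conclusion WITHOUT the normalisation `ν_j ≤ 1/4`. -/
def LogLoudStatesUnnormalised (f : UnitAddTorus (Fin 3) → EuclideanSpace ℝ (Fin 3)) : Prop :=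
  ∃ (ν : ℕ → ℝ) (E c : ℝ), (∀ j, 0 < ν j) ∧ Tendsto ν atTop (𝓝 0) ∧ 0 < c ∧ LogLoudAlong f ν E c

/-- **The clause `ν_j ≤ 1/4` is not load-bearing** (any force): it is removable by a tail shift of the sequence, so the
crux is equivalent to its unnormalised form. [folklore] -/
theorem logLoudStates_iff_unnormalised (f : UnitAddTorus (Fin 3) → EuclideanSpace ℝ (Fin 3)) :
    LogLoudStates f ↔ LogLoudStatesUnnormalised f := by
  constructor
  · rintro ⟨ν, E, c, hν, hlim, hc, h⟩
    exact ⟨ν, E, c, fun j => (hν j).1, hlim, hc, h⟩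
  · rintro ⟨ν, E, c, hν, hlim, hc, h⟩
    obtain ⟨J, hJ⟩ := Filter.eventually_atTop.1 (hlim.eventually (Iic_mem_nhds (by norm_num : (0 : ℝ) < 1 / 4)))
    refine ⟨fun j => ν (j + J), E, c, fun j => ⟨hν _, hJ _ (Nat.le_add_left J j)⟩,
      hlim.comp (tendsto_add_atTop_nat J), hc, fun j => h (j + J)⟩

/-- **#2 ⇒ #3.** Loud BOUNDED states (`LoudBoundedStates`, the sibling crux's conclusion) are log-loud: shift the sequence
into `ν_j ≤ 1/4` and take `E' = max E 0 / log 4` (`log(1/ν_j) ≥ log 4`). [folklore] -/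
theorem logLoudStates_of_loudBoundedStates : LoudBoundedStates tgForce → LogLoudStates tgForce := by
  rintro ⟨ν, E, ε, hν, hlim, hε, h⟩
  obtain ⟨J, hJ⟩ := Filter.eventually_atTop.1 (hlim.eventually (Iic_mem_nhds (by norm_num : (0 : ℝ) < 1 / 4)))
  refine ⟨fun j => ν (j + J), max E 0 / Real.log 4, ε, fun j => ⟨hν _, hJ _ (Nat.le_add_left J j)⟩,
    hlim.comp (tendsto_add_atTop_nat J), hε, fun j => ?_⟩
  refine (h (j + J)).mono fun N hN => ?_
  obtain ⟨U, hU, hUE, hloud⟩ := hN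
  refine ⟨U, hU, ?_, hloud⟩
  have hlog4 : Real.log 4 ≤ Real.log (1 / ν (j + J)) :=
    log_four_le_log_one_div (hν _) (hJ _ (Nat.le_add_left J j))
  have hlog4pos : 0 < Real.log 4 := Real.log_pos (by norm_num)
  have hE0 : 0 ≤ max E 0 / Real.log 4 := div_nonneg (le_max_right _ _) hlog4pos.le
  calc ∫ x, ‖U x‖ ^ 2 ≤ E := hUE
    _ ≤ max E 0 := le_max_left _ _
    _ = max E 0 / Real.log 4 * Real.log 4 := (div_mul_cancel₀ _ hlog4pos.ne').symm
    _ ≤ max E 0 / Real.log 4 * Real.log (1 / ν (j + J)) := mul_le_mul_of_nonneg_left hlog4 hE0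

/-- **Kill criterion K2 of the route, formal: refuting the log crux refutes the deciding crux #2.** [folklore] -/
theorem not_loud_of_not_logLoud :
    ¬ Summit.AnomalousDissipation.AnomalousDissipation.Theses.MirrorVariety.TaylorGreenLogLoudStates →
      ¬ Summit.AnomalousDissipation.AnomalousDissipation.Theses.MirrorVariety.TaylorGreenLoudGalerkinStates :=
  fun h h2 => h (logCrux_iff.2 (logLoudStates_of_loudBoundedStates
    (Summit.AnomalousDissipation.AnomalousDissipation.Theorems.TaylorGreenLoudGalerkinStates.Negative.crux_iff.1 h2)))

/-- **The negation of the crux, unfolded (pure logic).** `¬ crux` says: along EVERY sequence `0 < ν_j ≤ 1/4`, `ν_j → 0`,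
and for all `E`, `c > 0`, some `j` has, for INFINITELY MANY resolutions `N`, only quiet (`ν_j‖∇U‖² < c`) admissible
Taylor–Green states among those of energy `≤ E·log(1/ν_j)` — a uniform-in-`N` laminarisation theorem at logarithmically
growing energy. Nothing of the kind is known in 3-D. [folklore] -/
theorem not_logCrux_iff :
    ¬ Summit.AnomalousDissipation.AnomalousDissipation.Theses.MirrorVariety.TaylorGreenLogLoudStates ↔
      ∀ (ν : ℕ → ℝ) (E c : ℝ), (∀ j, 0 < ν j ∧ ν j ≤ 1 / 4) → Tendsto ν atTop (𝓝 0) → 0 < c →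
        ∃ j, ∃ᶠ N in atTop, ∀ U : UnitAddTorus (Fin 3) → EuclideanSpace ℝ (Fin 3),
          IsSteadyState (ν j) N tgForce U → ∫ x, ‖U x‖ ^ 2 ≤ E * Real.log (1 / ν j) → ν j * gradNormSq U < c := by
  rw [logCrux_iff]
  constructor
  · intro h ν E c hν hlim hc
    by_contra hcon
    refine h ⟨ν, E, c, hν, hlim, hc, fun j => ?_⟩
    have hj : ¬ ∃ᶠ N in atTop, ∀ U : UnitAddTorus (Fin 3) → EuclideanSpace ℝ (Fin 3),
        IsSteadyState (ν j) N tgForce U → ∫ x, ‖U x‖ ^ 2 ≤ E * Real.log (1 / ν j) → ν j * gradNormSq U < c :=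
      fun hf => hcon ⟨j, hf⟩
    rw [Filter.not_frequently] at hj
    refine hj.mono fun N hN => ?_
    by_contra hU
    refine hN fun U hS hE => ?_
    by_contra hlt
    exact hU ⟨U, hS, hE, not_lt.1 hlt⟩
  · rintro h ⟨ν, E, c, hν, hlim, hc, hL⟩
    obtain ⟨j, hj⟩ := h ν E c hν hlim hc
    obtain ⟨N, ⟨U, hS, hE, hloud⟩, hN⟩ := ((hL j).and_frequently hj).exists
    exact absurd (hN U hS hE) (not_lt.2 hloud)

/-! ### §3b PDE form of a refutation: it suffices to laminarise EXACT steady states (modulo the route's transfer)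

Through the route's own support item `FixedViscosityTransfer` (stmt-2991; Temam 1979 Ch. II Thm 1.2 (ii) run on the
given Galerkin zeros — "provable now from tree material" per the route, not yet landed) the log crux yields, at EVERY
`ν_j`, an EXACT steady weak solution `u_j ∈ V` of the Taylor–Green-forced Navier–Stokes equations with the energy
equation, `∫|u_j|² ≤ E·log(1/ν_j)` and `(f_TG, u_j) = ν_j‖∇u_j‖² ≥ c`. Hence a refutation need not mention Galerkin
truncations at all: a laminarisation theorem for exact steady states at log energy (`ExactSteadyLogLaminarisation`)
kills the crux, GIVEN the transfer. Recorded as an implication with both hypotheses explicit. -/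

/-- **Laminarisation of exact steady Taylor–Green states at logarithmic energy** (the PDE form of `¬ crux`): along every
`0 < ν_j ≤ 1/4`, `ν_j → 0`, for all `E` and `c > 0`, at some `j` EVERY steady weak solution `u ∈ V` at `ν_j` obeying the
energy equation and `∫|u|² ≤ E·log(1/ν_j)` has injection `(f_TG, u) < c`. OPEN (this is the 3-D steady laminarisation
problem at log energy); stated here only as the hypothesis of `not_logCrux_of_exact_laminarisation`. -/
def ExactSteadyLogLaminarisation : Prop :=
  ∀ (ν : ℕ → ℝ) (E c : ℝ), (∀ j, 0 < ν j ∧ ν j ≤ 1 / 4) → Tendsto ν atTop (𝓝 0) → 0 < c →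
    ∃ j, ∀ u : ↥(Literature.Analysis.FunctionSpaces.Torus.energySpace (Fin 3)),
      (u : MeasureTheory.Lp (EuclideanSpace ℝ (Fin 3)) 2
          (MeasureTheory.volume : MeasureTheory.Measure (UnitAddTorus (Fin 3)))) ∈
        Literature.Analysis.FunctionSpaces.Torus.energySpaceV (Fin 3) →
      Literature.Analysis.FluidPDE.Torus.IsSteadyWeakSolution (ν j) tgForce u →
      ν j * (Literature.Analysis.FunctionSpaces.Torus.eGradNormSq
          ((u : MeasureTheory.Lp (EuclideanSpace ℝ (Fin 3)) 2
            (MeasureTheory.volume : MeasureTheory.Measure (UnitAddTorus (Fin 3)))) :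
              UnitAddTorus (Fin 3) → EuclideanSpace ℝ (Fin 3))).toReal =
        Literature.Analysis.FluidPDE.Torus.pairing
          (u : MeasureTheory.Lp (EuclideanSpace ℝ (Fin 3)) 2
            (MeasureTheory.volume : MeasureTheory.Measure (UnitAddTorus (Fin 3)))) tgForce →
      ∫ x, ‖(u : MeasureTheory.Lp (EuclideanSpace ℝ (Fin 3)) 2
          (MeasureTheory.volume : MeasureTheory.Measure (UnitAddTorus (Fin 3)))) x‖ ^ 2 ≤ E * Real.log (1 / ν j) →
      Literature.Analysis.FluidPDE.Torus.pairing
          (u : MeasureTheory.Lp (EuclideanSpace ℝ (Fin 3)) 2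
            (MeasureTheory.volume : MeasureTheory.Measure (UnitAddTorus (Fin 3)))) tgForce < c

/-- **It suffices to laminarise exact steady states.** Given the route's transfer support `FixedViscosityTransfer`
(stmt-2991) and `ExactSteadyLogLaminarisation`, the log crux is false: transfer the crux's Galerkin zeros at `ν_j`
(energy budget `E·log(1/ν_j)`, loudness `c`) to an exact steady state `u_j ∈ V` with `(f_TG, u_j) ≥ c`, contradicting
laminarisation at the `j` it provides. [folklore] -/
theorem not_logCrux_of_exact_laminarisation
    (hT : Summit.AnomalousDissipation.AnomalousDissipation.Theses.MirrorVariety.FixedViscosityTransfer)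
    (hL : ExactSteadyLogLaminarisation) :
    ¬ Summit.AnomalousDissipation.AnomalousDissipation.Theses.MirrorVariety.TaylorGreenLogLoudStates := by
  rw [logCrux_iff]
  rintro ⟨ν, E, c, hν, hlim, hc, h⟩
  obtain ⟨j, hj⟩ := hL ν E c hν hlim hc
  obtain ⟨u, huV, husol, huE, huc, hueq⟩ := hT (ν j) (E * Real.log (1 / ν j)) c tgForce (hν j).1
    isSmooth_tgForce isDivFree_tgForce hasZeroMean_tgForce (h j).frequently
  exact absurd huc (not_le.2 (hj u huV husol hueq huE))

/-! ## Why the crux resists (summary; full discussion in `Cruxes/TaylorGreenLogLoudStates/Disproof.lean` §5)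

`¬ crux` (`not_logCrux_iff`) is a uniform-in-`N` laminarisation theorem for steady Galerkin Taylor–Green states at energy
`O(log(1/ν))` along every `ν_j → 0⁺` (equivalently, modulo the route's transfer, laminarisation of EXACT steady states at
log energy, `not_logCrux_of_exact_laminarisation`) — strictly harder than refuting the bounded-energy crux #2
(`not_loud_of_not_logLoud`), itself open in 3-D (the 2-D Alexakis–Doering enstrophy-balance argument has no
vortex-stretching term). The necessary conditions of these files are jointly satisfiable by the intended stretched-vortex
skeleton; the log clause is binding (a-priori energy ceiling `ν⁻²`), so the statement is not cheaply true either.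
-/

end Summit.AnomalousDissipation.AnomalousDissipation.Theorems.TaylorGreenLogLoudStates.Negative

end
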